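import Summits.QuantumFields.BalabanUV.Beta.EriceRemainderEnclosureHistoryAutonomyComparisonAgeCompositionStaticChain

/-!
# EriceRemainderEnclosureHistoryAutonomyComparisonAgeCompositionStaticChainSpikeFluid — (E72e) THE SPIKE (dense cluster at scale ratio → 1): inside it the load
# a member sees is EXACTLY `θ·(E − 1)`, and the constant-coefficient SPIKE FLUID `d log E∕dt = (a + θE)∕(D₀ − κt)` has the certified closed form
# `E = a·q∕(1 − θq)`, `q = (D₀∕(D₀ − κt))^{a∕κ}∕(a + θ)` — the explicit extremal model of route (N)'s near-window lemmas

Cell `pub-balaban`, β-function sub-cell, BINDER row D4 «RemainderConst leaves for Bałaban's split» (`HOME/BINDER-OWNERS.md`; owner lineage `b2b-balaban-beta-an4`;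
this file by co-owner #2 lineage `b2b-balaban-beta-d4-p2`, generation 63), β-FLOW TEAM duty (1), FREEZE (0) honoured (def-free; imports (E72a)
`…AgeCompositionStaticChain` for `sum_rho_mul_compounding`, used BY NAME; nothing restated).

HONEST FRAMING (page 1, verbatim and binding).  *"Discharging BetaPertH makes Bałaban's UV stability UNCONDITIONAL — a real constructive-QFT result; it is
NOT the continuum limit and NOT the Clay problem."*  THIS FILE DISCHARGES NOTHING OF THE KIND.  Elementary calculus (derivatives of `exp`, `log` and a quotient)
about an explicit function; the form, signs, ages and moments of Bałaban's (1.22) limit functional are NOT PRINTED ([I] p. 298; GAPS G-t4-U2-1∕-2) and NOT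
asserted.  Row D4 class UNCHANGED (critical-path width 0; instance 0∕1; D4 DISCHARGE NO DATE).  HONEST DEPENDENCY: continuum YM on T⁴ ⇐ BetaPertH ∧ nine spine
estimates (0/9 proved); BetaPertH ⇐ (D1) ∧ (D4) ∧ CAP+tail; G-an2-4 gates asym, D1 and NE2/3/4.

THE POINT (census sense (α); route (N), README `g63/e72` §5 «the spike fluid and its closed form», §7 (S1)∕(S2)).  NUMERICALLY every supremum of the two
near-window lemmas is attained on «young + uniform SPIKE of consecutive ages just above it (width 0.05–0.2 of the young scale, load X ≈ 0.35–0.5) + octave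
far comb» (t37: T 0.229, ρ 0.746, G_32 0.815, G_16 0.869 = the free-profile suprema of jobs j302670∕j302889).  Inside a spike every member sees the older
members with (nearly) ONE defect `θ` (`≤ θ̄(1) = 0.786`) and ONE charge `c` (`≤ 2(√2−1) = 0.828`), so: §1 **`spike_load_eq`** — with a constant defect the load
a member sees is EXACTLY `θ·(Π(1−ρ)⁻¹ − 1) = θ(E − 1)` ((E72a) `sum_rho_mul_compounding`); hence the multiplier of the next member is `(1 + Λ + θ(E−1))∕(1 −
√2(W_far + c·t))` (`t` = load consumed so far, `Λ`, `W_far` the far comb's aggregates), and the FLUID (infinitesimal members) obeys `d log E∕dt = (a +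
θE)∕(D₀ − κt)` with `a = 1 − θ + Λ`, `D₀ = 1 − √2W_far`, `κ = √2c`.  §2 certifies its CLOSED FORM: `hasDerivAt_exponent`, `hasDerivAt_q` (`q(t) =
e^{(a∕κ)(log D₀ − log(D₀−κt))}∕(a+θ) = (D₀∕(D₀−κt))^{a∕κ}∕(a+θ)`, `q' = q·a∕(D₀−κt)`), **`hasDerivAt_closed_form_of_q`** (algebraic core: any `q` with that
logarithmic derivative makes `Ē = a·q∕(1−θq)` satisfy `Ē' = Ē(a + θĒ)∕(D₀ − κt)` while `θq < 1`), **`hasDerivAt_spike_closed_form`**, `spike_closed_form_zero`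
(`Ē(0) = 1`).  NUMERICS of record (t38, t39): the closed form equals the numerical integration to 5 digits; with the spike's MEAN coefficients the fluid is 1–4 %
ABOVE the discrete spike chain in `e, V, ρ, T` at every width and load tested (z = 160), the worst-constant fluid a further 2–5 % above (pure spike, `x = 0.604 −
X`: sup T = 0.186 at X = 0.50, sup ρ = 0.706; discrete 0.168 ∕ 0.667); at second order in a member's load the fluid dominates an atom iff `κ ≥ a`, i.e. iff
`Λ ≤ θ + √2c − 1 ≈ 0.96` (so (S2) «fluid domination» needs that hypothesis or an atom-corrected majorant).  NOT CLAIMED: (S1) spike reduction, (S2) fluid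
domination, the near-window lemmas, uniqueness of the ODE solution (only that the closed form IS a solution with the right initial value); anything printed.
-/
noncomputable section

open Finset

namespace Summit.QuantumFields.BalabanUV.Beta.EriceRemainderEnclosureHistoryAutonomyComparisonAgeCompositionStaticChainSpikeFluid

open Summit.QuantumFields.BalabanUV.Beta.EriceRemainderEnclosureHistoryAutonomyComparisonAgeCompositionStaticChain (sum_rho_mul_compounding)

/-! ## §1 Inside a spike the load seen is `θ·(E − 1)` exactly -/

/-- **CONSTANT DEFECT ⟹ LOAD = θ·(COMPOUNDING − 1).**  If a member sees every older member with the same defect `θ`, the load it sees in the static chain is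
`Σ_{i<m} θ·ρ_i·Π_{i≤j<m}(1−ρ_j)⁻¹ = θ·(Π_{j<m}(1−ρ_j)⁻¹ − 1)` — (E72a) `sum_rho_mul_compounding`; so inside a spike the multiplier is a function of the
compounding so far only (no profile information is needed). [folklore] -/
theorem spike_load_eq {ρ : ℕ → ℝ} {m : ℕ} (hρ : ∀ j, j < m → ρ j ≠ 1) (θ : ℝ) :
    ∑ i ∈ range m, θ * (ρ i * ∏ j ∈ Ico i m, (1 - ρ j)⁻¹) = θ * ((∏ j ∈ range m, (1 - ρ j)⁻¹) - 1) := by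
  rw [← mul_sum, sum_rho_mul_compounding hρ]

/-! ## §2 The closed form of the spike fluid -/

/-- derivative of the exponent `g(t) = (a∕κ)(log D₀ − log(D₀ − κt))`: `g' = a∕(D₀ − κt)`. [folklore] -/
theorem hasDerivAt_exponent {a κ D0 t : ℝ} (hκ : κ ≠ 0) (hD : 0 < D0 - κ * t) :
    HasDerivAt (fun s : ℝ => a / κ * (Real.log D0 - Real.log (D0 - κ * s))) (a / (D0 - κ * t)) t := by
  have h1 : HasDerivAt (fun s : ℝ => D0 - κ * s) (-κ) t := by
    simpa using ((hasDerivAt_id t).const_mul κ).const_sub D0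
  have h2 : HasDerivAt (fun s : ℝ => Real.log (D0 - κ * s)) (-κ / (D0 - κ * t)) t := h1.log hD.ne'
  have h3 : HasDerivAt (fun s : ℝ => Real.log D0 - Real.log (D0 - κ * s)) (-(-κ / (D0 - κ * t))) t := h2.const_sub (Real.log D0)
  have h4 := h3.const_mul (a / κ)
  refine h4.congr_deriv ?_
  field_simp

/-- The spike fluid's `q`: `q(t) = e^{(a∕κ)(log D₀ − log(D₀−κt))}∕(a+θ)` has `q' = q·a∕(D₀ − κt)`. [folklore] -/
theorem hasDerivAt_q {a θ κ D0 t : ℝ} (hκ : κ ≠ 0) (hD : 0 < D0 - κ * t) :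
    HasDerivAt (fun s : ℝ => Real.exp (a / κ * (Real.log D0 - Real.log (D0 - κ * s))) / (a + θ))
      (Real.exp (a / κ * (Real.log D0 - Real.log (D0 - κ * t))) / (a + θ) * (a / (D0 - κ * t))) t := by
  have h := ((hasDerivAt_exponent (a := a) hκ hD).exp).div_const (a + θ)
  refine h.congr_deriv ?_
  ring

/-- **ALGEBRAIC CORE OF THE CLOSED FORM.**  If `q' = q·a∕(D₀ − κt)` at `t` and `θ·q(t) < 1`, then `Ē = a·q∕(1 − θq)` satisfies the spike fluid's ODE at `t`:
`Ē' = Ē·(a + θĒ)∕(D₀ − κt)`. [folklore] -/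
theorem hasDerivAt_closed_form_of_q {q : ℝ → ℝ} {a θ κ D0 t : ℝ} (hD : 0 < D0 - κ * t) (hq1 : θ * q t < 1)
    (hq : HasDerivAt q (q t * (a / (D0 - κ * t))) t) :
    HasDerivAt (fun s => a * q s / (1 - θ * q s))
      ((a * q t / (1 - θ * q t)) * (a + θ * (a * q t / (1 - θ * q t))) / (D0 - κ * t)) t := by
  have hnum : HasDerivAt (fun s => a * q s) (a * (q t * (a / (D0 - κ * t)))) t := hq.const_mul a
  have hden : HasDerivAt (fun s => 1 - θ * q s) (-(θ * (q t * (a / (D0 - κ * t))))) t := by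
    simpa using (hq.const_mul θ).const_sub 1
  have hden0 : 1 - θ * q t ≠ 0 := by linarith
  have h := hnum.div hden hden0
  refine h.congr_deriv ?_
  have hD' : D0 - κ * t ≠ 0 := hD.ne'
  -- both sides equal a²·q∕(D·(1−θq)²)
  have lhs : (a * (q t * (a / (D0 - κ * t))) * (1 - θ * q t) - a * q t * -(θ * (q t * (a / (D0 - κ * t))))) / (1 - θ * q t) ^ 2
      = a ^ 2 * q t / ((D0 - κ * t) * (1 - θ * q t) ^ 2) := by
    rw [div_eq_div_iff (pow_ne_zero 2 hden0) (mul_ne_zero hD' (pow_ne_zero 2 hden0))]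
    field_simp
    ring
  have hden0' : 1 - q t * θ ≠ 0 := by rwa [mul_comm] at hden0
  have e1 : a + θ * (a * q t / (1 - θ * q t)) = a / (1 - θ * q t) := by
    rw [eq_div_iff hden0]
    field_simp
    ring
  have rhs : (a * q t / (1 - θ * q t)) * (a + θ * (a * q t / (1 - θ * q t))) / (D0 - κ * t)
      = a ^ 2 * q t / ((D0 - κ * t) * (1 - θ * q t) ^ 2) := by
    rw [e1, div_mul_div_comm, div_div, div_eq_div_iff (mul_ne_zero (mul_ne_zero hden0 hden0) hD') (mul_ne_zero hD' (pow_ne_zero 2 hden0))]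
    ring
  rw [lhs, rhs]

/-- **THE SPIKE FLUID'S CLOSED FORM SOLVES ITS ODE.**  With `q(t) = e^{(a∕κ)(log D₀ − log(D₀−κt))}∕(a+θ)` and `Ē = a·q∕(1 − θq)` (README `g63/e72` §5:
`κ = √2·c`, `a = 1 − θ + Λ`): `Ē'(t) = Ē(t)·(a + θĒ(t))∕(D₀ − κt)` wherever `D₀ − κt > 0` and `θq(t) < 1` — i.e. `E(X) = a·q∕(1−θq)`,
`q = (D₀∕(D₀ − √2cX))^{a∕(√2c)}∕(a+θ)` is the compounding of the constant-coefficient spike fluid `d log E∕dt = (a + θE)∕(D₀ − √2ct)`. [folklore] -/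
theorem hasDerivAt_spike_closed_form {a θ κ D0 t : ℝ} (hκ : κ ≠ 0) (hD : 0 < D0 - κ * t)
    (hq1 : θ * (Real.exp (a / κ * (Real.log D0 - Real.log (D0 - κ * t))) / (a + θ)) < 1) :
    HasDerivAt
      (fun s : ℝ => a * (Real.exp (a / κ * (Real.log D0 - Real.log (D0 - κ * s))) / (a + θ)) /
        (1 - θ * (Real.exp (a / κ * (Real.log D0 - Real.log (D0 - κ * s))) / (a + θ))))
      ((a * (Real.exp (a / κ * (Real.log D0 - Real.log (D0 - κ * t))) / (a + θ)) /
          (1 - θ * (Real.exp (a / κ * (Real.log D0 - Real.log (D0 - κ * t))) / (a + θ)))) *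
        (a + θ * (a * (Real.exp (a / κ * (Real.log D0 - Real.log (D0 - κ * t))) / (a + θ)) /
          (1 - θ * (Real.exp (a / κ * (Real.log D0 - Real.log (D0 - κ * t))) / (a + θ))))) / (D0 - κ * t)) t :=
  hasDerivAt_closed_form_of_q (q := fun s => Real.exp (a / κ * (Real.log D0 - Real.log (D0 - κ * s))) / (a + θ)) hD hq1
    (hasDerivAt_q hκ hD)

/-- The closed form starts at `Ē(0) = 1` (for `a > 0`, `a + θ ≠ 0`). [folklore] -/
theorem spike_closed_form_zero {a θ κ D0 : ℝ} (ha : 0 < a) (hθ : 0 ≤ θ) :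
    a * (Real.exp (a / κ * (Real.log D0 - Real.log (D0 - κ * 0))) / (a + θ)) /
        (1 - θ * (Real.exp (a / κ * (Real.log D0 - Real.log (D0 - κ * 0))) / (a + θ))) = 1 := by
  have haθ : a + θ ≠ 0 := by linarith
  have ha' : a ≠ 0 := ha.ne'
  simp only [mul_zero, sub_zero, sub_self, Real.exp_zero]
  have h1 : 1 - θ * (1 / (a + θ)) = a / (a + θ) := by
    field_simp
    ring
  rw [h1, div_eq_one_iff_eq (div_ne_zero ha' haθ)]
  field_simp

end Summit.QuantumFields.BalabanUV.Beta.EriceRemainderEnclosureHistoryAutonomyComparisonAgeCompositionStaticChainSpikeFluid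

end
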